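import Summits.HodgeConjecture.HodgeConjecture.Theses.SiuRepresentability

/-!
# Route SiuRepresentability — `SectorGlue` (glue item stmt-HodgeConjecture-9031)

`SiuTransfer → KaehlerRepresentable → LefschetzOneOne → HardLefschetzReduction → BallQuotientHodge`:
the Hodge conjecture for a smooth projective `n`-fold uniformised by the ball.  The Hodge model is part
of the ball-quotient datum; the classes are treated by strong induction on the codimension `p`:
`p = 0` is trivial (`algebraicClasses_zero`), `p = 1` is the Lefschetz item, for `2 ≤ p ≤ n/2` the
class is a combination of representable classes (`KaehlerRepresentable`, complementary dimension
`k = n - p ≥ 2`) each of which is algebraic by `SiuTransfer`, and for `2p > n` hard Lefschetz reduces to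
codimension `n - p < p`.  Pure logic over the route file plus `algebraicClasses_zero`; no named-fact
hypothesis, no sorry.
-/

-- `Summit.HodgeConjecture.HodgeConjecture.Theorems` is the mandated namespace (single-problem
-- summit: Problem = Summit), which `linter.dupNamespace` flags on every declaration; the lakefile
-- turns the linter off tree-wide (weak option), restated here so stand-alone elaboration is
-- warning-free too.
set_option linter.dupNamespace false

namespace Summit.HodgeConjecture.HodgeConjecture.Theorems

open Literature.AlgebraicGeometry.HodgeTheory

/-- **Item stmt-HodgeConjecture-9031 (`SectorGlue`), route `SiuRepresentability`**: Hodge model from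
the datum; classes by strong induction on the codimension (`0`: trivial; `1`: Lefschetz; `2 ≤ p ≤ n/2`:
representable span + Siu transfer; `2p > n`: hard Lefschetz). [cite: Siu1980, Thm. 1] -/
theorem siuRepresentability_sectorGlue_proof :
    Summit.HodgeConjecture.HodgeConjecture.Theses.SiuRepresentability.SectorGlue := by
  intro hS hR hL hH n X hX hB
  refine ⟨?_, fun p ↦ ?_⟩
  · obtain ⟨A, -, -⟩ := hB
    exact ⟨A⟩
  · induction p using Nat.strong_induction_on with
    | _ p ih =>
    intro c hc hpp
    rcases Nat.lt_or_ge p 2 with hp2 | hp2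
    · interval_cases p
      · rw [algebraicClasses_zero]
        exact Submodule.mem_top
      · exact hL hX c hc hpp
    · rcases Nat.lt_or_ge n (2 * p) with hnp | hnp
      · exact hH n p hnp hX (fun c' hc' hpp' ↦ ih (n - p) (by omega) c' hc' hpp') c hc hpp
      · have hpk : p + (n - p) = n := by omega
        refine Submodule.span_le.2 ?_ (hR hX hB p (n - p) hpk hp2 hnp c hc hpp)
        rintro c' ⟨μX, M, hM, μM, f, h⟩
        exact hS hX hB p (n - p) hpk (by omega) μX M hM μM f c' h

end Summit.HodgeConjecture.HodgeConjecture.Theorems
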